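import Summits.BirchSwinnertonDyer.Rank1Residual.O5.O5GlobalLine
import Literature.NumberTheory.EllipticCurves.KunduRay2024.TamagawaGeneratorBound
import HarnessLib

/-!
# O5 — GEN 8: UNCLEAN congruent pairs mod 3 — the Tamagawa bits `[3 ∣ c_ℓ]`, the parity law T25, the
# disparity budget T25♯ and Selmer transfer beyond the clean webs (T25a); the 𝔽₃-shadow of the two-line lemma

Add-on to `O5GlobalLine` (GEN 7: `IsCongruentModThree`, `IsCleanPairAwayFromThree`, T23a–d, T24c; p295909).
Census cell O5 = (t′), o5-r1 GEN 8 (planner-b2b-bsdres-o5-r1-g8-0, 2026-08-21).  Theory: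
`HOME/b2b-bsdres-o5-r1/gen8/T25-UNCLEAN-PARITY.md` (Thms 7–9, L25, T25a–d); census `HOME/…/gen8/P-K14-PREREG.md`
(pre-registered, frozen sha16 `ce353cfa19a64635`, result §5).  HONEST FRAMING as in every file of the cell: every
node below is an `@[conjecture] def … : Prop` (THEOREM-CANDIDATE with a written, not kernel-checked, derivation, or a
research conjecture); nothing is asserted, nothing booked, no mark of `RESIDUAL-MAP.md` moves; census numbers are
EVIDENCE; no main conjecture, no `p`-adic `L`-function and no BSD formula is an input of any node.

## The mathematics in one paragraph (T25-UNCLEAN-PARITY.md §0–§1)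
For a prime `ℓ ≠ 3` and `ρ̄ = W[3]` (any member `W` of the mod-3 web), `H¹(ℚ_ℓ, ρ̄)` has dimension `2h⁰`,
`h⁰ = dim W(ℚ_ℓ)[3] ∈ {0,1,2}`, with a SYMMETRIC non-degenerate local Tate pairing for which the unramified subspace
and every Kummer image `F_ℓ(W)` are Lagrangian [cite: PoonenRains2012, Prop. 4.10–4.12, Thm. 4.13].  THEOREM 7
(written proof, §1.2): the TRANSVERSALITY BIT `t_ℓ(W) := dim F_ℓ(W)/(F_ℓ(W) ∩ H¹_ur)` equals `[3 ∣ c_ℓ(W)]` EXACTLY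
(`W₀(ℚ_ℓ^ur)` is 3-divisible, and a generator of `Φ(𝔽_ℓ)[3^∞]/3` has ramified Kummer class); at an `h⁰ = 1` prime the
plane `H¹(ℚ_ℓ, ρ̄)` is hyperbolic with EXACTLY TWO isotropic lines (`hyperbolicPlaneThree_isotropic_card` below is its
`𝔽₃`-shadow), so the local condition of a member there IS the bit `[3 ∣ c_ℓ]`.  With the GEN 6/7 dictionary at `3`
(two isotropic lines `κ` in `H¹(ℚ₃, V)`, classes III ↦ `ℓ₇^iso`, I₀*-ss ↦ `ℓ₅*`, III*/gss ↦ `ℓ₁*`; T19–T22) the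
DISPARITY theorem for Lagrangian Selmer structures [cite: KlagsbrunMazurRubin2013, the disparity theorem for self-dual
Selmer structures (restated: Klagsbrun–Mazur–Rubin, arXiv:1303.6507, Part II §4, Theorem citing [kmr], held text p. 15)]
gives T25: `dim Sel₃(W) − dim Sel₃(X) ≡ [κ_W ≠ κ_X] + n(W) + n(X) (mod 2)`, `n = #{ℓ ≠ 3 : 3 ∣ c_ℓ}`; linear algebra
gives the BUDGET T25♯ `|dim Sel₃(W) − dim Sel₃(X)| ≤ d(W,X)`, `≡ d (mod 2)`; and `d = 0` gives TRANSFER (T25a), which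
contains GEN 7's clean law T23a (`h⁰ = 0` at every bad prime) and the TIDY law (`3 ∤ c_ℓ` everywhere — the printed
case away from `p`: [cite: Cesnavicius2016SelmerFlat, Thm. 1.1 (b)(c)], whose hypotheses AT `p` exclude additive `3`)
as the special cases with no transverse prime.  The local sign lemma L25 (`w_ℓ(W)·(−1)^{[3 ∣ c_ℓ(W)]}` depends only on
`ρ̄|G_{ℚ_ℓ}`, case list §1.4) proves the root-number form independently and answers, in this setting, the question
printed in [cite: Cesnavicius2016SelmerFlat, §1, question after Thm. 1.1 ("Can one prove this directly?")].

## Typing notes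
`transversePrimesThree W` is cut out by `ℓ ∣ N_W` (so it is a set of divisors of a non-zero integer, finite without
proof obligations) and `KunduRay2024.PDvdTamagawaAt W 3 ℓ` (`3 ∣ c_ℓ(W)`, the tree's local Tamagawa number);
`transverseCountThree` is its `Set.ncard`.  `selmerDimThree W := padicValNat 3 (Nat.card (W.selmerGroup 3))`
(`#Sel₃ = 3^{dim}`; junk `0` only if the Selmer group were infinite).  The class bit `[κ_W ≠ κ_X]` of a CONGRUENT tame
pair is `[exactly one of W, X is I₀*-ss]` = `¬ (SubGss W 3 ↔ SubGss X 3)` (a `LocIrr` congruence between the `V₀`-class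
III* and the `V₁`-classes III / I₀* is impossible, T19a/T22, so no other cross term arises); the reduction-free form
uses GEN 5's finite 3-adic test `KummerTorsorsAgreeAtThree` exactly as T23d/T24c do.  `FullLocalThreeTorsionAt W ℓ`
(`h⁰ = 2`: two 3-torsion points with distinct `x`-coordinates rational over `ℚ_ℓ`) is the polynomial companion of GEN 5's
`NoLocalThreeTorsionAt` (`h⁰ = 0`).  The typed budget `disparityBudgetThree` is an UPPER bound for `d(W,X)` of Thm 9
(symmetric difference of the transverse sets + the class bit + `2·#`{transverse primes of full local 3-torsion}), which
is all the B-facing recipes use.  DEDUP: `lean search` for every new name → no match.  0 Literature facts; net debt 0.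

## TYPER PLACEMENT NOTE (cc-typer-5 GEN 9, typer of record O5 §3.5, 2026-08-21; ask A-O5-20)

HONEST FRAMING (cell `b2b-bsdres`, run/shared/lean/b2b/bsd-rank1-residual/, verbatim in every
file): the goal of the cell is to DELETE the COMBINATION-SHAPED residual classes of the
Birch–Swinnerton-Dyer formula for ALL analytic-rank `≤ 1` elliptic curves over `ℚ` — assembled
STRICTLY from published theorems — so that the rank-`≤ 1` remainder becomes exactly the
CONSTRUCTION-SHAPED classes, which are TYPED (missing-input `Prop`s), NOT attempted. This is not
"finishing BSD". Lane CLASS-CLOSURE (`CLASS-CLOSURE-PLAN.md` §3.5 O5; deliverables (a) STATEMENT DISCOVERY —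
T25 / T25♯ / T25a are EVIDENCE-labelled conjecture nodes with a PRE-REGISTERED census (P-K14, `gen8/P-K14-PREREG.md`
sha16 `53c6172d7c2f9580`, §0–§4 frozen as `ce353cfa19a64635` BEFORE the run, zero kit) — and (c) TRANSPORT: each
node is a COMPARISON STATEMENT along a mod-3 CONGRUENCE, the Selmer dimension / root number transported across a
congruent pair with the Tamagawa bits `[3 ∣ c_ℓ]` as the correction, printed antecedents KMR 2013 (disparity),
Poonen–Rains 2012 (Lagrangian Kummer images), Mazur–Rubin 2007 (local constants), Česnavičius 2016 (tidy transfer),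
Dokchitser–Dokchitser 2010 (3-parity), Kobayashi 2002 (`w₃`)): research routes; no claim beyond the stated classes;
census output is EVIDENCE / conjecture items, never a Literature fact; nothing is booked; no mark of `RESIDUAL-MAP.md`
moves. NO Literature fact is minted here.

PROVENANCE. The module text above this note and every declaration below are o5-r1 GEN 8's draft
`HOME/b2b-bsdres-o5-r1/gen8/O5UncleanParity.lean` (sha16 `878a544f8248dee3`, 227 lines; `HOME/INBOX.md` o5-r1 GEN 8
line 2026-08-21T18:38Z, ask A-O5-20; derivation `gen8/T25-UNCLEAN-PARITY.md` sha16 `4a3684d2c4b88f07`), with EVERY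
declaration BYTE-IDENTICAL; the only typer change is this note. DEDUP re-run by the typer (`lean search --decl` on all
14 new names: no match); vocabulary reused, not re-declared: `KunduRay2024.PDvdTamagawaAt` (`3 ∣ c_ℓ` on the
`ℤ_ℓ`-minimal model, Literature), `WeierstrassCurve.selmerGroup`, Mathlib's `Ψ₃` / `Ψ₂Sq`, GEN 5's
`IsKummerBasePointThree` / `KummerTorsorsAgreeAtThree`, GEN 7's `IsCongruentModThree`, the tree Predicates `ClassO5` /
`SubGss` / `LocIrr`. Audit advisories (as in GEN 5 / GEN 7): `FullLocalThreeTorsionAt` and `SameTransverseBitsThree`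
are untagged predicates WITH BODIES (census-decidable vocabulary — the audit files every untagged `def : Prop` under
'vendored-fact'; nothing is assumed about them), and the four PROVED lemmas are 'orphan' until a consumer imports
them. Every `[cite: …]` key is in `references.bib` (KlagsbrunMazurRubin2013, PoonenRains2012,
Cesnavicius2016SelmerFlat, DokchitserDokchitserAnnals2010, Kobayashi2002 — checked).

CHECK STATUS at landing. o5-r1's check units for THIS file are E92′ := R12–R15 (Thm 7b at `ℓ = 2` / `c = 3` types;
L25 case δ; KMR applicability; the `h⁰ = 2` slack), requested from harvest-2 in the same line and NOT yet delivered.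
What HAS arrived (harvest-2 GEN 43 'E92' = the GEN 7 units R8–R11, `HOME/b2b-bsdres-harvest-2/gen43/E92-T23-check.md`
sha16 `dcbfb816c4c65b2e`, 18:40Z — two minutes after this draft): R8 ✓ in all three parts (so T25♭'s "why it might
fail: Thm 5 (R8(b))" is discharged ON PAPER; Thm 5 = Mazur–Rubin 2007 Prop. 1.3 (i), Thm 5′'s parity form = MR07
Thm 1.4), R9 ✓ with wording precisions R9-i/ii, R11 (parity fixes the type), and R10: the local sign law behind
T24 / T24c / T23d is Burungale–Kobayashi–Nakamura–Ota, arXiv:2508.17776 Thm 1.3(4) / Thm 1.10 — a PREPRINT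
(ANNOUNCED, never a kernel input); the printed antecedent of L25 at `ℓ ≠ 3` (unclean pairs included) is Nekovář,
Compositio 151 (2015) 1626–1646 [`(−1)^{δ_v(T,T′)} = ε_v(V)/ε_v(V′)`, `δ_v = dim 𝓕_v/(𝓕_v ∩ 𝓕′_v)`; primary text
requested, acq-09724]. None of this changes a statement here; the tags stay `@[conjecture]` until a
KERNEL proof (cc-lead ⟦gen22⟧ (8)(b), ⟦gen23⟧ (8)(c): tag = kernel status, docstring = paper status).

CHECK NOTE 2 (cc-typer-5 GEN 10, 2026-08-21; DOC-ONLY — every declaration and statement below is byte-identical to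
p299132, tags unchanged). **The check units R12–R15 HAVE NOW ARRIVED: harvest-2 GEN 43 E95**
(`HOME/b2b-bsdres-harvest-2/gen43/E95-T25-check.md` sha16 `ce214f7e025554d1`, `HOME/INBOX.md` 2026-08-21T19:02Z;
o5-r1's "E92′" renumbered E95) — **R12 ✓ R13 ✓ R14 ✓ R15 ✓**, with these precisions, none of which changes a
statement: (R12) Thm 7b (`t_ℓ(W) = [3 ∣ c_ℓ(W)]` for every `ℓ ≠ 3`, `ℓ = 2` included) verified step by step
(`W₀(ℚ_ℓ^{ur})` 3-divisible; `W/W₀ = Φ(𝔽_ℓ)` with cyclic 3-part; "unramified ⟺ `P ∈ 3W(ℚ_ℓ^{ur})`"; IV/IV* have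
geometric `Φ = ℤ/3` at every residue characteristic) and a SIMPLIFICATION at `ℓ = 2`: `3 ∣ c₂` ⟹ Kodaira IV/IV* ⟹
`f₂ = v(Δ) + 1 − m = 2` (Ogg–Saito; the only rows are `(4,5,4)`, `(≥6,5,4)`, `(4,6,8)`, `(≥7,7,8)` of Rizzo 2003
Table III) ⟹ TAME, `Φ = C₃` — so the "wild types with `3 ∣ c₂`" of the derivation's §1.4 (δ) DO NOT EXIST (a wild
potentially good `Φ` at `2` has even order, `−1 ∈ Φ̄`, `ρ̄^{I₂} = 0`, `h⁰ = 0` — Thm 7e from the other side); (R13)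
the printed value is `W₂ = −1` on all four IV/IV* rows of Table III [Rizzo2003, Table III p. 5; = the tree's
`KellockDokchitser.w2Table`, `RootNumberTableTwo.lean`], hence `σ₂(IV/IV*) = (−1)(−1)¹ = +1 = σ₂`(non-split
multiplicative, `3 ∤ v`) — L25 at `2` holds EXACTLY as demanded, no empirical residue; and **L25 in general (every
`ℓ ≠ 3`, every `h⁰`) = Nekovář, Compositio 151 (2015) [`(−1)^{δ_ℓ} = w_ℓ(W)/w_ℓ(X)`] + Thm 7 [`δ_ℓ ≡ t_W + t_X (mod 2)`
in all `h⁰ ∈ {0,1,2}` configurations; the `h⁰ = 2` good/split-cube case `δ = 1`, `w·w′ = −1` hand-checked]** — the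
cases (α)–(δ) are its member-type verification ("cleanliness aligns" / "transversality aligns" = the `h⁰ = 0` /
`h⁰ = 1` halves); (R14) the parity formula used is **Mazur–Rubin 2007 Thm 1.4 VERBATIM** [MazurRubin2007, Thm. 1.4
— `K` a number field, `p` ODD, `T` a finite `𝔽_p`-space with a perfect skew-symmetric `G_K`-pairing into `μ_p`,
Selmer structures unramified a.e., self-dual `F_v = F_v^⊥` everywhere; NO image / irreducibility hypothesis] — to be
cited as PRIMARY (KMR 2013 Part II §1 restates it); Prop. 1.3 (i) is the exact count behind Thm 9 / T25d; (R15)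
`δ(F(W), F(X)) = d(W,X) − 2·#{h⁰ = 2 split/split primes with ιT_W = T_X}`, `|Δ dim| ≤ δ ≤ d`, `Δ ≡ δ ≡ d (mod 2)`,
`d = 1` exact — all ✓; precision R15-i: the "index 3 at one `h⁰ = 1` place" of §1.5 is the NET of the all-places
Greenberg–Wiles product `3` (at `3`: `#κ/#H⁰`) `· 3` (at `ℓ₀`: `9/3`) `· 1/3` (`∞`, ordinary `H⁰` — E92 R8(b)), the
`3·(1/3)` cancelling because `S_κ` is self-dual — so `a + b = 1` ✓, `μ = 1 − 2a ∈ {±1}` ✓. PLACEMENT (BC8 prior-art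
list, adding to E92's): Thm 8 = T25 = MR07 Thm 1.4 on `(F(W), F(X))` + Thm 7b + T20–T22; L25 = Nekovář 2015 + Thm 7;
Thm 9 / T25d = MR07 Prop 1.3 (i) + Thm 7; §2.3 "`κ_W = κ_X ⟺ w₃` equal STILL holds for unclean pairs" ✓ and for a
web-free reason — BKNO Thm 1.3 is LOCAL at `3` (typed meanwhile as T24ℓ `O5.KummerLineByLocalRootNumberThree`,
`O5/O5KummerLineLocalSign.lean`, A-O5-21). The DELTA that survives a literature referee (harvest-2's wording): the
member-level bit dictionary with the EXACT budget and its census (the `[evidence]` line below), the web invariants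
`λ(ρ̄) = H¹_{−(−1)^s P}` and `μ(ρ̄; κ, ℓ₀)`, the explicit conductor dictionary at `3`. On Česnavičius's printed
question (arXiv:1301.4724 p. 4): the ROOT-NUMBER form and the SELMER-dimension form follow (Nekovář / MR07 +
Česnavičius Thm 1.1); the RANK form needs Ш-finiteness or 3-parity — NOT claimed by any node here (T25r consumes
per-curve 3-parity as an explicit hypothesis of `rootNumberTamagawaParity_of_parityLaw`). S1 honesty ✓ (no Heegner
input; the caution `P(ℚ)[3] = 0` holds by irreducibility). KERNEL STATUS: unchanged — every node of this file stays an
`@[conjecture]` obligation (checked ON PAPER ≠ proved in the kernel); census EVIDENCE; nothing booked; no mark of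
`RESIDUAL-MAP.md` moves; O5 OPEN.

[evidence: census cell O5, o5-r1 GEN 8, P-K14 (80 397 tame/gss congruent pairs mod 3, N < 5·10⁵, 35 122 curves; per-prime bits from Tate's algorithm validated against Cremona's ∏c on 35 122/35 122 curves; 8 false links removed at ℓ = 107): arm 14-B parity law 0 exceptions / 80 389 (uncorrected clean law: 41 925 failures); 14-B′ sign form 0 / 39 184; 14-A d = 0 transfer 0 / 10 018 (clean 2 291, tidy 5 513, shared-transverse 2 214); 14-C budget 0 / 80 386 with d = 1 ⇒ |Δ| = 1 on 32 038 / 32 038]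
-/

open scoped Classical

open Polynomial WeierstrassCurve Literature.NumberTheory.EllipticCurves
  Summit.BirchSwinnertonDyer.Rank1Residual.Additive

namespace Summit.BirchSwinnertonDyer.Rank1Residual.O5

/-! ## §1 Vocabulary: transverse primes, Selmer dimension, full local 3-torsion, the typed budget -/

/-- **Transverse primes of `W` (mod 3)**: primes `ℓ ≠ 3` of bad reduction with `3 ∣ c_ℓ(W)`.  By THEOREM 7 of
T25-UNCLEAN-PARITY.md these are exactly the primes where the Kummer condition `F_ℓ(W) ⊂ H¹(ℚ_ℓ, W[3])` is NOT the
unramified Lagrangian (`t_ℓ(W) = [3 ∣ c_ℓ(W)]`).  Census name: `T(W)`; `n(W) = #T(W)`. [folklore] -/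
def transversePrimesThree (W : WeierstrassCurve ℚ) [W.IsElliptic] [W.IsGloballyMinimal] : Set ℕ :=
  {ℓ | ℓ.Prime ∧ ℓ ≠ 3 ∧ (ℓ : ℤ) ∣ W.conductorNorm ℤ ∧ KunduRay2024.PDvdTamagawaAt W 3 ℓ}

/-- `n(W) := #{ℓ ≠ 3 : 3 ∣ c_ℓ(W)}` (a finite set: divisors of the conductor). [folklore] -/
noncomputable def transverseCountThree (W : WeierstrassCurve ℚ) [W.IsElliptic] [W.IsGloballyMinimal] : ℕ :=
  (transversePrimesThree W).ncard

/-- `dim_{𝔽₃} Sel₃(W)`, read off the order `#Sel₃(W) = 3^{dim}`. [folklore] -/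
noncomputable def selmerDimThree (W : WeierstrassCurve ℚ) [W.IsElliptic] : ℕ :=
  padicValNat 3 (Nat.card (W.selmerGroup 3))

/-- **Full local 3-torsion at `ℓ`** (`h⁰(ℚ_ℓ, W[3]) = 2`): two `ℚ_ℓ`-rational 3-torsion points with distinct
`x`-coordinates, as the polynomial condition "two distinct `ℚ_ℓ`-roots of `Ψ₃` at which `Ψ₂²` is a square" (companion
of `NoLocalThreeTorsionAt`, which is `h⁰ = 0`).  For `ℓ ≠ 3` this forces `ℓ ≡ 1 (mod 3)` and good or split
multiplicative reduction with `3 ∣ v_ℓ(Δ)` (Thm 7 (d)); census: 1 419 incidences, all of that shape. [folklore] -/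
def FullLocalThreeTorsionAt (W : WeierstrassCurve ℚ) (ℓ : ℕ) [Fact ℓ.Prime] : Prop :=
  ∃ x₁ x₂ s₁ s₂ : ℚ_[ℓ], x₁ ≠ x₂ ∧ (W.baseChange ℚ_[ℓ]).Ψ₃.IsRoot x₁ ∧ (W.baseChange ℚ_[ℓ]).Ψ₃.IsRoot x₂ ∧
    ((W.baseChange ℚ_[ℓ]).Ψ₂Sq).eval x₁ = s₁ ^ 2 ∧ ((W.baseChange ℚ_[ℓ]).Ψ₂Sq).eval x₂ = s₂ ^ 2

/-- **Class bit of a tame pair**: `[κ_W ≠ κ_X]` = `[exactly one of W, X is I₀*-supersingular]` (T22: the classes III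
and I₀*-ss carry the two DIFFERENT isotropic lines `ℓ₇^iso ≠ ℓ₅*` of `H¹(ℚ₃, V₁)`; III*, gss share `ℓ₁*`). [folklore] -/
noncomputable def crossBitThree (W X : WeierstrassCurve ℚ) [W.IsElliptic] [W.IsGloballyMinimal]
    [X.IsElliptic] [X.IsGloballyMinimal] : ℕ :=
  if (SubGss W 3 ↔ SubGss X 3) then 0 else 1

/-- **Typed disparity budget** (an upper bound for `d(W,X)` of T25-UNCLEAN-PARITY.md Thm 9): the class bit, plus the
primes where exactly one of the two has `3 ∣ c_ℓ`, plus `2` for every transverse prime of full local 3-torsion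
(`h⁰ = 2`, where two transverse members may still carry different Lagrangians). [folklore] -/
noncomputable def disparityBudgetThree (W X : WeierstrassCurve ℚ) [W.IsElliptic] [W.IsGloballyMinimal]
    [X.IsElliptic] [X.IsGloballyMinimal] : ℕ :=
  crossBitThree W X + (symmDiff (transversePrimesThree W) (transversePrimesThree X)).ncard +
    2 * {ℓ ∈ transversePrimesThree W ∪ transversePrimesThree X |
          ∃ hℓ : ℓ.Prime, @FullLocalThreeTorsionAt W ℓ ⟨hℓ⟩}.ncard

/-- **Same transverse bits and no doubly-rational transverse prime** — the typed form of `d(W,X) = [κ_W ≠ κ_X]`: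
`T(W) = T(X)` and `h⁰ ≤ 1` at every transverse prime.  Contains CLEAN (`IsCleanPairAwayFromThree`: then `T = ∅` on
both sides, Thm 7 (e)/(b)) and TIDY (`3 ∤ c_ℓ` on both sides). [folklore] -/
def SameTransverseBitsThree (W X : WeierstrassCurve ℚ) [W.IsElliptic] [W.IsGloballyMinimal]
    [X.IsElliptic] [X.IsGloballyMinimal] : Prop :=
  transversePrimesThree W = transversePrimesThree X ∧
    ∀ (ℓ : ℕ) (hℓ : ℓ.Prime), ℓ ∈ transversePrimesThree W → ¬ @FullLocalThreeTorsionAt W ℓ ⟨hℓ⟩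

/-! ## §2 The 𝔽₃-shadow of Theorem 7 (c): a hyperbolic plane over 𝔽₃ has exactly two isotropic lines -/

/-- In the hyperbolic plane (`𝔽₃²`, `q(x,y) = xy`) the non-zero isotropic vectors are the `4 = 2·(3−1)` vectors on
the two coordinate axes: EXACTLY TWO isotropic lines.  This is the linear algebra behind "at an `h⁰ = 1` prime the
local condition of a member is one bit" (Thm 7 (c)): `H¹(ℚ_ℓ, ρ̄)` is a non-degenerate symmetric plane containing the
isotropic line `H¹_ur`, hence hyperbolic. Kernel-checked by `decide`. [folklore] -/
theorem hyperbolicPlaneThree_isotropic_card :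
    (Finset.univ.filter (fun v : ZMod 3 × ZMod 3 => v ≠ 0 ∧ v.1 * v.2 = 0)).card = 4 := by decide

/-- … and every non-zero isotropic vector lies on one of the two axes (the two isotropic LINES). [folklore] -/
theorem hyperbolicPlaneThree_isotropic_on_axes :
    ∀ v : ZMod 3 × ZMod 3, v.1 * v.2 = 0 → v.1 = 0 ∨ v.2 = 0 := by decide

/-! ## §3 T25 — the unclean parity law (tame form and reduction-free Kummer-torsor form) -/

/-- **T25 `UncleanParityLawThree` (THEOREM-CANDIDATE, o5-r1 GEN 8; derivation T25-UNCLEAN-PARITY.md Thm 8 = KMR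
disparity + Thm 7 + T20–T22).**  For two curves of class O5 at `3` (tame potentially supersingular: III, I₀*-ss, III*),
`W[3]` irreducible locally at `3` and globally, congruent mod `3` — NO cleanliness hypothesis — the 3-Selmer dimensions
satisfy `dim Sel₃(W) + dim Sel₃(X) ≡ [exactly one is I₀*-ss] + n(W) + n(X) (mod 2)`, `n = #{ℓ ≠ 3 : 3 ∣ c_ℓ}`.
Special cases: T23a/T23b parity (clean), and the TIDY parity law.  Why it might fail: through T20–T22 (line
dictionary at `3`), or at `ℓ = 2` with wild `ρ̄(I₂)` and `3 ∣ c₂` (check unit R13) — the census has 1 848 such incidences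
and no exception.
[evidence: census cell O5, o5-r1 GEN 8, P-K14 arm 14-B (rank form, ranks of record): 0 exceptions / 80 389 pairs — clean 3 266, tidy-unclean 7 206, other 69 917; the law WITHOUT the Tamagawa bits fails on 41 925 of them] -/
@[conjecture] def UncleanParityLawThree : Prop :=
  ∀ (W X : WeierstrassCurve ℚ) [W.IsElliptic] [W.IsGloballyMinimal] [X.IsElliptic] [X.IsGloballyMinimal],
    ClassO5 W 3 → ClassO5 X 3 → LocIrr W 3 → W.HasIrreducibleModPGaloisRep 3 →
    IsCongruentModThree W X →
      Even (selmerDimThree W + selmerDimThree X + crossBitThree W X +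
        transverseCountThree W + transverseCountThree X)

/-- **T25♭ `SelmerParityReadsKummerLineThree` (THEOREM-CANDIDATE given Thm 5 of GEN 7; reduction-free form of T25,
extending T23d `SelmerReadsKummerLineThree` to unclean pairs).**  For a mod-3 congruent pair, locally irreducible at
`3`, ANY reduction at `3` (tame or WILD additive, or good supersingular): the Kummer torsors at `3` agree (GEN 5's finite
3-adic test) iff `dim Sel₃(W) + dim Sel₃(X) + n(W) + n(X)` is even.  This is the parity law offered to the wild cell O6
(T24c's unclean correction, T25-UNCLEAN-PARITY.md §2.3).  Why it might fail: Thm 5 (R8(b)) or R13.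
[evidence: census cell O5, o5-r1 GEN 8: on tame~tame / tame~gss pairs = T25's evidence (80 389 pairs, 0 exceptions); tame~wild pairs: P-K13 not run] -/
@[conjecture] def SelmerParityReadsKummerLineThree : Prop :=
  ∀ (W X : WeierstrassCurve ℚ) [W.IsElliptic] [W.IsGloballyMinimal] [X.IsElliptic] [X.IsGloballyMinimal],
    LocIrr W 3 → W.HasIrreducibleModPGaloisRep 3 → IsCongruentModThree W X →
      ∀ x y x' y' : ℚ_[3], IsKummerBasePointThree W x y → IsKummerBasePointThree X x' y' →
        (KummerTorsorsAgreeAtThree W X x x' ↔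
          Even (selmerDimThree W + selmerDimThree X + transverseCountThree W + transverseCountThree X))

/-- **T25r `RootNumberTamagawaParityThree` (THEOREM-CANDIDATE; two derivations: T25 + Cassels–Tate + 3-parity
[cite: DokchitserDokchitserAnnals2010, Thm. 1.4], or LOCALLY by the sign lemma L25 — `w_ℓ(W)·(−1)^{[3 ∣ c_ℓ(W)]}` is a
function of `ρ̄|G_{ℚ_ℓ}` for `ℓ ≠ 3` (T25-UNCLEAN-PARITY.md §1.4, cases α–δ; Rohrlich at additive `ℓ ≥ 5`) — with
Kobayashi at `3` [cite: Kobayashi2002, Thm. 1.1].)**  `w(W)·w(X) = (−1)^{[exactly one is I₀*-ss] + n(W) + n(X)}` for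
congruent O5 pairs.  The Tamagawa-free tidy case over prime-to-3 conductors is the root-number form of the question
printed in [cite: Cesnavicius2016SelmerFlat, §1 (question after Thm. 1.1)].  Why it might fail: L25 case δ (`ℓ = 2`).
[evidence: census cell O5, o5-r1 GEN 8, P-K14 arm 14-B′ (rank-free: away-from-3 local sign products with the Tamagawa bits, rows additive at 2 excluded): 0 exceptions / 39 184 pairs; arm 14-B: 0 / 80 389] -/
@[conjecture] def RootNumberTamagawaParityThree : Prop :=
  ∀ (W X : WeierstrassCurve ℚ) [W.IsElliptic] [W.IsGloballyMinimal] [X.IsElliptic] [X.IsGloballyMinimal],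
    ClassO5 W 3 → ClassO5 X 3 → LocIrr W 3 → W.HasIrreducibleModPGaloisRep 3 →
    IsCongruentModThree W X →
      W.rootNumber * X.rootNumber =
        (-1) ^ (crossBitThree W X + transverseCountThree W + transverseCountThree X)

/-! ## §4 T25♯ / T25a — the disparity budget and Selmer transfer beyond the clean webs -/

/-- **T25♯ `SelmerDisparityBudgetThree` (THEOREM-CANDIDATE; T25-UNCLEAN-PARITY.md Thm 9: `H¹_F ∩ H¹_G = H¹_{F∩G}`
has codimension `≤ Σ_v dim F_v/(F_v ∩ G_v)` in each, + Thm 7).**  For congruent O5 pairs (hypotheses of T25):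
`dim Sel₃(W) ≤ dim Sel₃(X) + budget(W,X)` (and symmetrically), `budget` = the typed `disparityBudgetThree` (class bit
+ primes where the bits `[3 ∣ c_ℓ]` differ + `2` per transverse prime of full local 3-torsion).  B-FACING READING
(EVIDENCE framing, nothing closed): LOWER — a rank-0 row `E` with a partner `P` of `rank(P) − budget ≥ 1` has
`dim Sel₃(E) ≥ 1`, hence `≥ 2` by parity, hence `9 ∣ #Ш(E)[3]`, needing only `P`'s points; UPPER — a rank-1 curve `P`
with a rank-0 partner `E`, `Sel₃(E) = 0` (Kato-provable in shape on tidy O5 rank-0 rows: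
`Kato2004.rankZero_padicValNat_sha_le_sub_localTamagawa_of_additive_potGood_of_imageContainsSL2`) and `budget ≤ 2`
has `dim Sel₃(P) = 1`, `Ш(P)[3] = 0` — INCLUDING `P` with `3 ∣ ∏ c_ℓ(P)` (TAM-DEFECT type).  Why it might fail: only
with Thm 7 (b) (`t_ℓ = [3 ∣ c_ℓ]`) at `ℓ = 2`.
[evidence: census cell O5, o5-r1 GEN 8, P-K14 arm 14-C (s = rank + v₃(Ш_an)): |Δs| ≤ d and Δs ≡ d (mod 2) on 80 386 / 80 386 pairs, table d×Δs = {0:{0:10 018}, 1:{±1: 32 038}, 2:{−2: 6 452, 0: 18 551, +2: 622}, 3:{±3: 41, ±1: 11 472}, 4:{…}, 5:{…}}; arm 14-D1: 543 LOWER-9 rank-0 rows with rank(P) − d ≥ 1 (GEN 7 clean recipe 157); supplement S1: 2 012 rank-1 O5 curves (889 with 3 ∣ ∏c) + 1 818 rank-1 gss curves with a tidy rank-0 O5 partner, 3 ∤ Ш_an(E)·∏c(E), d ≤ 2 — all 3 830 have 3 ∤ Ш_an(P) (0 contradiction candidates)] -/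
@[conjecture] def SelmerDisparityBudgetThree : Prop :=
  ∀ (W X : WeierstrassCurve ℚ) [W.IsElliptic] [W.IsGloballyMinimal] [X.IsElliptic] [X.IsGloballyMinimal],
    ClassO5 W 3 → ClassO5 X 3 → LocIrr W 3 → W.HasIrreducibleModPGaloisRep 3 →
    IsCongruentModThree W X →
      selmerDimThree W ≤ selmerDimThree X + disparityBudgetThree W X

/-- **T25a `SelmerTransferSharedBitsThree` (THEOREM-CANDIDATE; T25-UNCLEAN-PARITY.md Cor. T25a: `d = 0` ⇒ equal
Selmer structures `F(W) = F(X)`, by Thm 7 (c) at the transverse primes and T19–T21 at `3`).**  T23a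
`SelmerTransferTameClassThree` with `IsCleanPairAwayFromThree` REPLACED by `SameTransverseBitsThree`: same symbol at
`3`, congruent, the same primes `ℓ ≠ 3` with `3 ∣ c_ℓ` on both sides and none of them of full local 3-torsion ⇒
`#Sel₃(W) = #Sel₃(X)`.  New content over GEN 7: pairs SHARING transverse primes (two members with `3 ∣ c_ℓ` at the
same `h⁰ = 1` prime carry the SAME Lagrangian there — the second isotropic line).  Why it might fail: Thm 7 (c) needs
`h⁰ = 1`; at `h⁰ = 2` two transverse members can differ (census: 629 doubly-transverse h⁰ = 2 pairs, Δs ≠ 0 on 441).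
[evidence: census cell O5, o5-r1 GEN 8, P-K14 arm 14-A: s_E = s_P on 10 018 / 10 018 d = 0 pairs — clean 2 291 (= P-K12 arm C), tidy-both 5 513, SHARED-TRANSVERSE 2 214] -/
@[conjecture] def SelmerTransferSharedBitsThree : Prop :=
  ∀ (W X : WeierstrassCurve ℚ) [W.IsElliptic] [W.IsGloballyMinimal] [X.IsElliptic] [X.IsGloballyMinimal],
    ClassO5 W 3 → ClassO5 X 3 → LocIrr W 3 → W.HasIrreducibleModPGaloisRep 3 →
    padicValRat 3 W.Δ = padicValRat 3 X.Δ →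
    IsCongruentModThree W X → SameTransverseBitsThree W X →
      Nat.card (W.selmerGroup 3) = Nat.card (X.selmerGroup 3)

/-! ## §5 Bookkeeping (PROVED): the root-number form follows from the parity law and per-curve 3-parity -/

/-- If `w = (−1)^a`, `v = (−1)^b` (3-parity + Cassels–Tate for each curve: `w(E) = (−1)^{dim Sel₃(E)}` when
`E(ℚ)[3] = 0`) and `a + b + k` is even (T25 with `k = [cross] + n(W) + n(X)`), then `w·v = (−1)^k` (T25r).  Pure
arithmetic; recorded so that the assembly T25 + parity ⟹ T25r is kernel-checked once the parity facts are instantiated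
from the tree. [folklore] -/
theorem rootNumber_mul_of_parityLaw {a b k : ℕ} {w v : ℤ} (hw : w = (-1) ^ a) (hv : v = (-1) ^ b)
    (h : Even (a + b + k)) : w * v = (-1) ^ k := by
  subst hw; subst hv
  have h1 : ((-1 : ℤ) ^ (a + b)) * (-1) ^ k = 1 := by
    rw [← pow_add]; exact h.neg_one_pow
  have h2 : ((-1 : ℤ) ^ k) * (-1) ^ k = 1 := by
    rw [← pow_add, ← two_mul]; exact (even_two_mul k).neg_one_pow
  calc (-1 : ℤ) ^ a * (-1) ^ b = (-1) ^ (a + b) := (pow_add _ _ _).symm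
    _ = (-1) ^ (a + b) * ((-1) ^ k * (-1) ^ k) := by rw [h2, mul_one]
    _ = ((-1) ^ (a + b) * (-1) ^ k) * (-1) ^ k := by ring
    _ = (-1) ^ k := by rw [h1, one_mul]

/-- The instance used in the census: T25 (as `Even (a + b + k)`) and the two parity facts give T25r's sign identity
for the pair, with `k = crossBitThree W X + n(W) + n(X)`. [folklore] -/
theorem rootNumberTamagawaParity_of_parityLaw (W X : WeierstrassCurve ℚ) [W.IsElliptic] [W.IsGloballyMinimal]
    [X.IsElliptic] [X.IsGloballyMinimal]
    (hW : W.rootNumber = (-1) ^ selmerDimThree W) (hX : X.rootNumber = (-1) ^ selmerDimThree X)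
    (h : Even (selmerDimThree W + selmerDimThree X + crossBitThree W X +
      transverseCountThree W + transverseCountThree X)) :
    W.rootNumber * X.rootNumber =
      (-1) ^ (crossBitThree W X + transverseCountThree W + transverseCountThree X) := by
  refine rootNumber_mul_of_parityLaw hW hX ?_
  simpa [add_assoc] using h

end Summit.BirchSwinnertonDyer.Rank1Residual.O5
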